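import Summits.CriticalPhenomena.PercolationContinuityZ3.Theorems.Transplant.PyrochloreLattice
import Summits.CriticalPhenomena.PercolationContinuityZ3.Theorems.Transplant.StatementBenjaminiSchramm
import Literature.Probability.Percolation.CubicCriticalProbTriangularStrict
import Literature.Probability.Percolation.SiteBoundedDegreeCriticalProb
import Literature.Probability.Percolation.BoundedDegreeCriticalProb
import Literature.Barriers.CriticalPhenomena.SubexponentialGrowthZdProofs
import HarnessLib

/-!
# Covering (line) graphs inherit the hypotheses of Benjamini–Schramm's Conjecture 4 — scope of the gen-13 SITE rows; the pyrochlore lattice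
# is a genuine (non-vacuous) instance of Conjecture 4 for site percolation

builds on p205010 (kernel theorem, internal audit signed; external expert review pending).
Status sentence (coordinator 2026-08-20T04:30Z): "θ(p_c) = 0 on ℤ^d, all d ≥ 2 — kernel-verified (Lean 4/Mathlib,
standard axioms); internal adversarial audit SIGNED 2026-08-20 04:29Z; external expert review pending."

Lane `prim-bschramm-*`, seat `prim-bschramm-p2` (gen 13).  Companion ("scope/audit") file of `LineGraphSiteContinuity.lean` and
`PyrochloreLattice.lean`, in the pattern of the lane's `…Scope` files: the conclusions `θ^{site}(p_c^{site}) = 0` proved there are instances of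
`BenjaminiSchramm1996_conj4_site` (`StatementBenjaminiSchramm.lean`: `∀ G [LocallyFinite], Connected → IsQuasiTransitive → ∀ x, p_c^{site} < 1 →
θ^{site}_x(p_c^{site}) = 0`) whose HYPOTHESES hold — so the rows are not vacuous.  Generic: the line graph of a locally finite / connected /
quasi-transitive graph is locally finite / connected / quasi-transitive (`nonempty_lineGraph_locallyFinite`, `lineGraph_preconnected`,
`lineGraph_isQuasiTransitive`; Kesten 1982 §2.5 Comment (iii) for paths, the induced automorphisms `SimpleGraph.Iso.lineGraph` of Mathlib for
transitivity), and `site_conj4_case_lineGraph` (the conjecture's body for every line graph whose parent bond row is proved).  Pyrochlore: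
`pyrochloreGraph_connected`, `pyrochlore_isQuasiTransitive`, `siteCriticalProb_pyrochlore_pos` (`0 < p_c^{site}`), `_lt_one`, the six
neighbours of the origin, **`pyrochlore_site_conj4_hypotheses`** and **`site_conj4_instance_pyrochlore`**.
[cite: BenjaminiSchramm1996, Conj. 4 and §2] [cite: Kesten1982, §2.5 Comment 2.5 (iii)] [cite: Henley2001, §1]
-/

noncomputable section

namespace Summit.CriticalPhenomena.PercolationContinuityZ3.Theorems.Transplant

open MeasureTheory Literature.Probability.Percolation Literature.Probability.LatticeModels SimpleGraph
open Literature.Barriers.CriticalPhenomena (IsQuasiTransitive)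

/-! ## §1 Line graphs inherit local finiteness, connectedness and quasi-transitivity -/

section Generic

variable {V : Type} {G : SimpleGraph V}

/-- The neighbours of `ṽ(e)` in the line graph are among the bonds incident to the two endpoints of `e`; for a locally finite graph these are
finitely many. [cite: Kesten1982, §2.5 Def. 2.13] -/
theorem lineGraph_neighborSet_finite [DecidableEq V] [G.LocallyFinite] (e : G.edgeSet) : (G.lineGraph.neighborSet e).Finite := by
  have hfin : (⋃ v ∈ {v : V | v ∈ (e : Sym2 V)}, (Subtype.val ⁻¹' G.incidenceSet v : Set G.edgeSet)).Finite := by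
    refine Set.Finite.biUnion ?_ fun v _ => (G.incidenceSet v).toFinite.preimage Subtype.val_injective.injOn
    obtain ⟨z, hz⟩ := e
    induction z using Sym2.ind with
    | h a b =>
      refine (Set.toFinite ({a, b} : Set V)).subset ?_
      intro w hw
      rcases Sym2.mem_iff.1 hw with rfl | rfl <;> simp
  refine hfin.subset ?_
  intro f hf
  obtain ⟨-, v, hv, hvf⟩ := lineGraph_adj_iff_exists.1 hf
  simp only [Set.mem_iUnion, Set.mem_setOf_eq, Set.mem_preimage, exists_prop]
  exact ⟨v, hv, f.2, hvf⟩

/-- **The line graph of a locally finite graph is locally finite** (existence of the `LocallyFinite` structure; instances are not declared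
in this proof file). [cite: Kesten1982, §2.5 Def. 2.13] -/
theorem nonempty_lineGraph_locallyFinite [DecidableEq V] [G.LocallyFinite] : Nonempty G.lineGraph.LocallyFinite :=
  ⟨fun e => (lineGraph_neighborSet_finite e).fintype⟩

/-- **Paths downstairs give paths upstairs** (Kesten 1982 Comment 2.5 (iii) with every bond open): if `a ∈ e` and `G` joins `a` to `c`, then either
`c = a` or some bond `f ∋ c` is joined to `e` in the line graph. [cite: Kesten1982, §2.5 Comment 2.5 (iii)] -/
theorem lineGraph_reachable_of_reachable (e : G.edgeSet) {a c : V} (ha : a ∈ (e : Sym2 V)) (h : G.Reachable a c) :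
    c = a ∨ ∃ f : G.edgeSet, c ∈ (f : Sym2 V) ∧ G.lineGraph.Reachable e f := by
  have hω : (G.edgeSet : Set (Sym2 V)) ⊆ G.edgeSet := le_rfl
  have hopen : openGraph (G.edgeSet : BondConfig V) = G := fromEdgeSet_edgeSet G
  obtain ⟨q⟩ := h
  have q' : (openGraph (G.edgeSet : BondConfig V)).Walk a c := q.transfer _ (by
    intro d hd; rw [hopen]; exact Walk.edges_subset_edgeSet q hd)
  rcases exists_edge_of_openWalk hω q' e e.2 ha with h | ⟨f, hcf, hf⟩
  · exact Or.inl h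
  · refine Or.inr ⟨f, hcf, hf.mono ?_⟩
    exact inf_le_left

/-- **The line graph of a preconnected graph is preconnected.** [cite: Kesten1982, §2.5 Comment 2.5 (iii)] -/
theorem lineGraph_preconnected (hG : G.Preconnected) : G.lineGraph.Preconnected := by
  intro e f
  have ha := Sym2.out_fst_mem (e : Sym2 V)
  have hc := Sym2.out_fst_mem (f : Sym2 V)
  rcases lineGraph_reachable_of_reachable e ha (hG _ ((f : Sym2 V).out.1)) with h | ⟨g, hcg, hg⟩
  · -- `e` and `f` share the vertex `a = c`
    by_cases hef : e = f
    · rw [hef]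
    · refine Adj.reachable (lineGraph_adj_iff_exists.2 ⟨hef, (e : Sym2 V).out.1, ha, ?_⟩)
      rw [← h]; exact hc
  · refine hg.trans ?_
    by_cases hgf : g = f
    · rw [hgf]
    · exact Adj.reachable (lineGraph_adj_iff_exists.2 ⟨hgf, (f : Sym2 V).out.1, hcg, hc⟩)

/-- **The line graph of a connected graph with at least one bond is connected.** [cite: Kesten1982, §2.5 Comment 2.5 (iii)] -/
theorem lineGraph_connected (hG : G.Connected) (e₀ : G.edgeSet) : G.lineGraph.Connected :=
  { preconnected := lineGraph_preconnected hG.preconnected, nonempty := ⟨e₀⟩ }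

/-- The automorphism of the line graph induced by `γ ∈ Aut(G)` (Mathlib `Iso.lineGraph`) maps `ṽ(e)` to `ṽ(γ e)`. [folklore] -/
theorem coe_iso_lineGraph_apply (γ : G ≃g G) (e : G.edgeSet) :
    ((Iso.lineGraph γ e : G.edgeSet) : Sym2 V) = Sym2.map γ (e : Sym2 V) := rfl

/-- **The line graph of a locally finite quasi-transitive graph is quasi-transitive**: the finitely many bonds at a fundamental set of vertices
form a fundamental set of bonds for the induced automorphisms. [cite: BenjaminiSchramm1996, §2 (quasi-transitive graphs)] -/
theorem lineGraph_isQuasiTransitive [DecidableEq V] [G.LocallyFinite] (h : IsQuasiTransitive G) : IsQuasiTransitive G.lineGraph := by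
  obtain ⟨V₀, hV₀⟩ := h
  have hfin : {f : G.edgeSet | ∃ v ∈ V₀, v ∈ (f : Sym2 V)}.Finite := by
    have h1 : (⋃ v ∈ (V₀ : Set V), (Subtype.val ⁻¹' G.incidenceSet v : Set G.edgeSet)).Finite :=
      Set.Finite.biUnion V₀.finite_toSet fun v _ => (G.incidenceSet v).toFinite.preimage Subtype.val_injective.injOn
    refine h1.subset ?_
    rintro f ⟨v, hv, hvf⟩
    simp only [Set.mem_iUnion, Set.mem_preimage, Finset.mem_coe, exists_prop]
    exact ⟨v, hv, f.2, hvf⟩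
  refine ⟨hfin.toFinset, fun e => ?_⟩
  obtain ⟨γ, hγ⟩ := hV₀ ((e : Sym2 V).out.1)
  refine ⟨Iso.lineGraph γ, ?_⟩
  rw [Set.Finite.mem_toFinset]
  refine ⟨γ ((e : Sym2 V).out.1), hγ, ?_⟩
  rw [coe_iso_lineGraph_apply, Sym2.mem_map]
  exact ⟨_, Sym2.out_fst_mem _, rfl⟩

/-- **Benjamini–Schramm's Conjecture 4 for SITE percolation holds on the line graph of every countable graph whose BOND model dies at its own
critical point at every vertex** — the conjecture's body (`… → p_c^{site} < 1 → θ^{site}(p_c^{site}) = 0`) for `G.lineGraph`; the `p_c < 1`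
hypothesis is not needed. [cite: BenjaminiSchramm1996, Conj. 4] [cite: Kesten1982, §3.1 Prop. 3.1] -/
theorem site_conj4_case_lineGraph [Countable V] (h : ∀ v : V, theta G v (criticalProbIOf G v) = 0) :
    ∀ e : G.edgeSet, siteCriticalProb G.lineGraph e < 1 →
      siteTheta G.lineGraph e ⟨siteCriticalProb G.lineGraph e, siteCriticalProb_mem_Icc G.lineGraph e⟩ = 0 :=
  fun e _ => lineGraph_siteCriticalContinuity_of_bond h e

/-- `0 < p_c^{site}(G̃, ṽ(e))` whenever the parent graph has bounded degree (`p_c^{site}(G̃) = p_c^{bond}(G) ≥ 1/(D+1)`). [cite: Kesten1982, §3.1 Prop. 3.1] -/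
theorem siteCriticalProb_lineGraph_pos [Countable V] [G.LocallyFinite] {D : ℕ} (hD : ∀ v, G.degree v ≤ D) (e : G.edgeSet) :
    0 < siteCriticalProb G.lineGraph e := by
  rw [siteCriticalProb_lineGraph_eq e (Sym2.out_fst_mem _)]
  exact criticalProb_pos_of_degree_le G hD _

end Generic

/-! ## §2 The pyrochlore lattice meets every hypothesis of Conjecture 4 (site) -/

/-- **The pyrochlore lattice is connected** (line graph of the connected diamond lattice, transported along `pyrochloreIso`).
[cite: Henley2001, §1] -/
theorem pyrochloreGraph_connected : pyrochloreGraph.Connected :=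
  (Iso.connected_iff pyrochloreIso).2
    (lineGraph_connected diamondGraph_connected (pyrochloreIso pyrochloreOrigin))

/-- **The pyrochlore lattice is quasi-transitive** (induced automorphisms of `diamondGraph.lineGraph`, transported along `pyrochloreIso`).
[cite: BenjaminiSchramm1996, §2] -/
theorem pyrochlore_isQuasiTransitive : IsQuasiTransitive pyrochloreGraph := by
  classical
  exact Literature.Probability.Percolation.CubicTriStrict.isQuasiTransitive_of_iso pyrochloreIso
    (lineGraph_isQuasiTransitive diamond_isQuasiTransitive)

/-- **`0 < p_c^{site}(pyrochlore)`** (`= p_c^{bond}(diamond) ≥ 1/(Δ+1)`, diamond has bounded degree). [cite: Henley2001, Table 1] -/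
theorem siteCriticalProb_pyrochlore_pos (m : pyrochloreSite) : 0 < siteCriticalProb pyrochloreGraph m := by
  classical
  have h := congrArg Subtype.val (siteCriticalProbIOf_pyrochlore_eq m)
  simp only [coe_siteCriticalProbIOf] at h
  rw [h]
  obtain ⟨Δ, hΔ⟩ := diamond_isQuasiTransitive.exists_degree_le
  exact criticalProb_pos_of_degree_le diamondGraph hΔ diamondOrigin

/-- **`p_c^{site}(pyrochlore) < 1`** (`≤ 1/2`). [cite: Henley2001, Table 1] -/
theorem siteCriticalProb_pyrochlore_lt_one (m : pyrochloreSite) : siteCriticalProb pyrochloreGraph m < 1 :=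
  (siteCriticalProb_pyrochlore_le_half m).trans_lt (by norm_num)

/-- The six nearest neighbours of the origin in the coordinate model: `±(0,1,1), ±(1,0,1), ±(1,1,0)` are pyrochlore sites adjacent to `0`
(corner-sharing tetrahedra `{0,(0,1,1),(1,0,1),(1,1,0)}` and `{0,−(0,1,1),−(1,0,1),−(1,1,0)}`). [cite: Henley2001, §1] -/
theorem pyrochlore_origin_neighbours :
    (![0, 1, 1] : Site 3) ∈ pyrochloreSite ∧ (![1, 0, 1] : Site 3) ∈ pyrochloreSite ∧ (![1, 1, 0] : Site 3) ∈ pyrochloreSite ∧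
    (![0, -1, -1] : Site 3) ∈ pyrochloreSite ∧ (![-1, 0, -1] : Site 3) ∈ pyrochloreSite ∧ (![-1, -1, 0] : Site 3) ∈ pyrochloreSite ∧
    (∀ u : Site 3, (u = ![0, 1, 1] ∨ u = ![1, 0, 1] ∨ u = ![1, 1, 0] ∨ u = ![0, -1, -1] ∨ u = ![-1, 0, -1] ∨ u = ![-1, -1, 0]) →
      (distSqGraph 3 2).Adj (0 : Site 3) u) := by
  refine ⟨by simp [mem_pyrochloreSite_iff], by simp [mem_pyrochloreSite_iff], by simp [mem_pyrochloreSite_iff],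
    by simp [mem_pyrochloreSite_iff], by simp [mem_pyrochloreSite_iff], by simp [mem_pyrochloreSite_iff], ?_⟩
  rintro u (rfl | rfl | rfl | rfl | rfl | rfl) <;>
    refine ⟨by decide, by simp [Fin.sum_univ_three]⟩

/-- … while the other fcc neighbours of the origin, e.g. `(0,1,−1)`, and the next site along an axis, `(2,0,0)`, are NOT pyrochlore sites
(every second fcc site is deleted). [cite: Henley2001, §1] -/
theorem pyrochlore_origin_nonNeighbours :
    (![0, 1, -1] : Site 3) ∉ pyrochloreSite ∧ (![2, 0, 0] : Site 3) ∉ pyrochloreSite := by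
  constructor <;> simp [mem_pyrochloreSite_iff]

/-- **The pyrochlore lattice meets EVERY hypothesis of Benjamini–Schramm's Conjecture 4 (site version)**: connected, locally finite [instance],
quasi-transitive, `0 < p_c^{site} < 1` at every site — the gen-13 site row is a genuine instance. [cite: BenjaminiSchramm1996, Conj. 4] -/
theorem pyrochlore_site_conj4_hypotheses :
    pyrochloreGraph.Connected ∧ IsQuasiTransitive pyrochloreGraph ∧
      ∀ m : pyrochloreSite, 0 < siteCriticalProb pyrochloreGraph m ∧ siteCriticalProb pyrochloreGraph m < 1 :=
  ⟨pyrochloreGraph_connected, pyrochlore_isQuasiTransitive,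
    fun m => ⟨siteCriticalProb_pyrochlore_pos m, siteCriticalProb_pyrochlore_lt_one m⟩⟩

/-- **Conjecture 4 (site) AT `G = pyrochloreGraph`, in the conjecture's exact binder shape** (`BenjaminiSchramm1996_conj4_site` specialised),
PROVED — builds on p205010 (kernel theorem, internal audit signed; external expert review pending). [cite: BenjaminiSchramm1996, Conj. 4] -/
theorem site_conj4_instance_pyrochlore :
    pyrochloreGraph.Connected → IsQuasiTransitive pyrochloreGraph →
      ∀ m : pyrochloreSite, siteCriticalProb pyrochloreGraph m < 1 →
        siteTheta pyrochloreGraph m ⟨siteCriticalProb pyrochloreGraph m, siteCriticalProb_mem_Icc pyrochloreGraph m⟩ = 0 :=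
  fun _ _ m _ => pyrochlore_siteCriticalContinuity m

/-- Had `BenjaminiSchramm1996_conj4_site` been available as a hypothesis, it would give the same conclusion — the instance is the conjecture's
`pyrochloreGraph` case (consistency of binder shapes). [cite: BenjaminiSchramm1996, Conj. 4] -/
theorem pyrochlore_siteCriticalContinuity_of_conj4_site (h : BenjaminiSchramm1996_conj4_site) (m : pyrochloreSite) :
    siteTheta pyrochloreGraph m (siteCriticalProbIOf pyrochloreGraph m) = 0 :=
  h pyrochloreGraph pyrochloreGraph_connected pyrochlore_isQuasiTransitive m (siteCriticalProb_pyrochlore_lt_one m)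

end Summit.CriticalPhenomena.PercolationContinuityZ3.Theorems.Transplant

end
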